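import Literature.AlgebraicGeometry.Motives.CartierDivisorSameDivisorOfOrdAt
import Literature.AlgebraicGeometry.Motives.AbelianVarietyAmpleOfFiniteComponentStabilizer
import Literature.AlgebraicGeometry.Motives.SymmetricPowerSplitDivisors
import Literature.AlgebraicGeometry.Motives.AbelianVarietyWeilPairingRadical
import Literature.AlgebraicGeometry.Motives.AbelianVarietyTranslationLemma
import HarnessLib

/-!
# An automorphism fixing every prime component of an effective divisor fixes the divisor;
# Mumford §6 Application 1 in the `K(D)` currency for an ARBITRARY effective divisor

Layer `Literature/AlgebraicGeometry/Motives`, namespaces `Literature.AlgebraicGeometry.Motives.CartierDivisor` (§1) and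
`Literature.AlgebraicGeometry.Motives.AbelianVariety` (§2–§3).  KERNEL ONLY (theorems; no definition, no named fact, no
instance, no `sorry`).  Cell `hodgecm-mathlib`, road G5, (App1-gen) FILE 2 over FILE 1 ★ `CartierDivisorSameDivisorOfOrdAt`
(`Div(X) → Z¹(X)` injective on a regular scheme) and ★ `AbelianVarietyAmpleOfFiniteComponentStabilizer` (A-p12 (g10):
Mumford §6 Appl. 1 with the COMPONENT stabiliser).

* §1 On a regular integral locally Noetherian scheme `X`: an automorphism `g` with `g(cl ζ) = cl ζ` for every codimension-one
  point `ζ` of `Supp E` (`E` effective) satisfies `ord_{g z}(E) = ord_z(E)` at every codimension-one point `z`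
  (`CartierDivisor.IsEffective.ordAt_base_eq_of_forall_image_closure_eq`) — a codimension-one point of `Supp E` IS one of the
  `ζ`, and `g ζ = ζ`; off the support both orders vanish — hence `g^*E ≈ E` (`…pullback_sameDivisor_of_forall_image_closure_eq`,
  by FILE 1 and ★ `CartierDivisor.ordAt_pullback_of_isIso`);
* §2 On an abelian variety over any field: `t_x(cl ζ) = cl ζ` for every prime component of `Supp D` ⇒ `t_x^*D ≈ D` ⇒
  `x ∈ K(D)` (`AbelianVariety.mem_KTheta_of_forall_image_translation_closure_eq`); so the component stabiliser is finite as
  soon as `K(D)(k)` is (`finite_componentStabilizer_of_finite_KTheta`);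
* §3 **Mumford, *Abelian Varieties*, §6 Application 1, (ii) ⇒ (iv), for an ARBITRARY effective divisor**: `D ≥ 0` with `K(D)(k)`
  finite (a fortiori `K(D) = ⊥`) on an abelian variety over `k = k̄` is AMPLE — granted the translation lemma (H) for divisors
  with irreducible support (hypothesis `hH`, letter of `Motives/AbelianVarietyTranslationLemma` quantified over the divisor, as in
  ★ `AbelianVarietyAmpleOfFiniteComponentStabilizer`);
* §4 (ed. 2) the UNCONDITIONAL forms over ★ `Motives/AbelianVarietyTranslationLemma` ((H), A-p06 (g16)):
  `isAmple_of_finite_KTheta`, `isAmple_of_KTheta_eq_bot`, and the equivalence `isAmple_iff_finite_KTheta` (Mumford §6 Appl. 1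
  (ii) ⇔ (iv) for an effective divisor; ⇒ is ★ `AbelianVariety.finite_KTheta`);
* §5 (ed. 3) Mumford's `H(D) = {x : t_x^*D = D}` (divisor-stabiliser, `SameDivisor` currency): `isAmple_of_finite_sameDivisorStabilizer`
  and `isAmple_iff_finite_sameDivisorStabilizer` ((i) ⇔ (iv)), so that (i) ⇔ (ii) ⇔ (iv) of Application 1 are all in the tree for
  an arbitrary effective divisor.

## References

* [MumfordAV1970] D. Mumford, *Abelian Varieties*, TIFR Studies in Mathematics 5 (1970), §6, Application 1 and its proof,
  pp. 60–61.
* [Hartshorne1977] R. Hartshorne, *Algebraic Geometry*, GTM 52 (1977), II.6, Prop. 6.11 and Remark 6.11.2 (pp. 141–142).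
-/

set_option autoImplicit false

noncomputable section

open CategoryTheory AlgebraicGeometry TopologicalSpace Order
open Literature.AlgebraicGeometry.Resolution Literature.RingTheory.RegularLocalRing

universe u

namespace Literature.AlgebraicGeometry.Motives

/-! ## §1 Automorphisms fixing the prime components of `Supp E` fix `E` (regular schemes) -/

namespace CartierDivisor

variable {X : Scheme.{u}} [IsIntegral X]

omit [IsIntegral X] in
/-- A point `z` of codimension one lying in the closure of a point `ζ` of codimension one IS `ζ` (coheight is strictly
antitone on proper specialisations; `X` is T₀). [folklore] -/
private theorem eq_of_mem_closure_of_coheight_eq_one {ζ z : X} (hz : z ∈ closure ({ζ} : Set X))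
    (hζ : coheight ζ = 1) (hz1 : coheight z = 1) : z = ζ := by
  have hsp : ζ ⤳ z := specializes_iff_mem_closure.mpr hz
  have hle : z ≤ ζ := hsp
  by_contra hne
  have hlt : z < ζ :=
    lt_of_le_not_ge hle fun h' => hne (Specializes.antisymm (show z ⤳ ζ from h') hsp).eq
  have hfin : coheight ζ < ⊤ := by rw [hζ]; exact ENat.coe_lt_top 1
  have := coheight_strictAnti hlt hfin
  rw [hζ, hz1] at this
  exact lt_irrefl _ this

omit [IsIntegral X] in
/-- For a homeomorphism onto itself (an automorphism `g`), `g(cl ζ) = cl ζ` forces `g ζ = ζ` (generic points are unique in a T₀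
space). [folklore] -/
private theorem base_eq_of_image_closure_eq (g : X ⟶ X) [IsIso g] {ζ : X}
    (h : g.base '' closure ({ζ} : Set X) = closure {ζ}) : g.base ζ = ζ := by
  have h1 : g.base '' closure ({ζ} : Set X) = closure {g.base ζ} := by
    have := (Scheme.Hom.homeomorph g).image_closure ({ζ} : Set X)
    rw [Set.image_singleton] at this
    exact this
  rw [h1] at h
  have a : g.base ζ ⤳ ζ := specializes_iff_mem_closure.mpr (h ▸ subset_closure rfl)
  have b : ζ ⤳ g.base ζ := specializes_iff_mem_closure.mpr (h.symm ▸ subset_closure rfl)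
  exact (a.antisymm b).eq

omit [IsIntegral X] in
/-- At a codimension-one point of a regular scheme the local ring is a discrete valuation ring (regular of dimension one;
Matsumura Thm. 11.2). [cite: Matsumura1987, Thm. 11.2 (p. 79)] -/
theorem isDiscreteValuationRing_stalk_of_coheight_eq_one [IsLocallyNoetherian X] (hX : Scheme.IsRegular X) {z : X}
    (hz : coheight z = 1) :
    haveI : IsRegularLocalRing (X.presheaf.stalk z) := hX z
    haveI := isDomain_of_isRegularLocalRing (X.presheaf.stalk z)
    IsDiscreteValuationRing (X.presheaf.stalk z) := by
  haveI : IsRegularLocalRing (X.presheaf.stalk z) := hX z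
  have hdim : ringKrullDim (X.presheaf.stalk z) = 1 := by
    rw [AlgebraicGeometry.ringKrullDim_stalk_eq_coheight z, hz]; rfl
  exact isDiscreteValuationRing_of_ringKrullDim_eq_one (R := X.presheaf.stalk z) hdim

/-- **An automorphism fixing every prime component of `Supp E` preserves the orders of `E` at all codimension-one points**:
`E ≥ 0` on the regular integral Noetherian `X`, `g : X ≅ X` with `g(cl ζ) = cl ζ` for every codimension-one point `ζ` of `Supp E`;
then `ord_{g z}(E) = ord_z(E)` for every `z` of codimension one — for `z ∈ Supp E = ⋃_ζ cl ζ` (★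
`compl_nonvanishing_one_eq_biUnion_closure`), `z` is one of the `ζ` and `g z = z`; for `z ∉ Supp E`, also `g z ∉ Supp E = g(Supp E)`
and both orders vanish. [cite: Hartshorne1977, II.6 Prop. 6.11 and Remark 6.11.2 (pp. 141–142)] -/
theorem IsEffective.ordAt_base_eq_of_forall_image_closure_eq [IsNoetherian X] (hX : Scheme.IsRegular X)
    {E : CartierDivisor X} (hE : E.IsEffective) (g : X ⟶ X) [IsIso g]
    (hfix : ∀ ζ ∈ divisorialPoints hE.idealSheaf, g.base '' closure ({ζ} : Set X) = closure {ζ})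
    {z : X} (hz : coheight z = 1) : E.ordAt (g.base z) = E.ordAt z := by
  by_cases hzS : z ∈ (E.nonvanishing 1)ᶜ
  · -- `z` is a codimension-one point of the support: it is one of the `ζ`, fixed by `g`
    rw [hE.compl_nonvanishing_one_eq_biUnion_closure hX] at hzS
    obtain ⟨ζ, hζ, hzζ⟩ := Set.mem_iUnion₂.mp hzS
    have hzeq : z = ζ := eq_of_mem_closure_of_coheight_eq_one hzζ hζ.2 hz
    subst hzeq
    rw [base_eq_of_image_closure_eq g (hfix z hζ)]
  · -- off the support both orders vanish
    have hz0 : z ∈ E.nonvanishing 1 := not_not.mp hzS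
    have hS : g.base '' (E.nonvanishing 1)ᶜ = (E.nonvanishing 1)ᶜ := by
      rw [hE.compl_nonvanishing_one_eq_biUnion_closure hX, Set.image_iUnion₂]
      exact Set.iUnion₂_congr fun ζ hζ => hfix ζ hζ
    have hgz : g.base z ∈ E.nonvanishing 1 := by
      by_contra hc
      have hc' : g.base z ∈ (E.nonvanishing 1)ᶜ := hc
      rw [← hS] at hc'
      obtain ⟨w, hw, hwz⟩ := hc'
      have : w = z := (Scheme.Hom.homeomorph g).injective hwz
      subst this
      exact hw hz0
    rw [(avoids_iff_mem_nonvanishing_one.mpr hgz).ordAt_eq_zero, (avoids_iff_mem_nonvanishing_one.mpr hz0).ordAt_eq_zero]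

/-- **An automorphism fixing every prime component of `Supp E` fixes the divisor: `g^*E ≈ E`** (`X` regular, integral,
Noetherian; `E ≥ 0`): at every codimension-one point `z`, `ord_z(g^*E) = ord_{g z}(E)` (★ `ordAt_pullback_of_isIso`, the stalks
being discrete valuation rings) `= ord_z(E)` (previous lemma), and a Cartier divisor on a regular scheme is determined by its
orders at the codimension-one points (FILE 1 ★ `sameDivisor_of_forall_ordAt_eq`). [cite: Hartshorne1977, II.6 Prop. 6.11 and Remark 6.11.2 (pp. 141–142)] -/
theorem IsEffective.pullback_sameDivisor_of_forall_image_closure_eq [IsNoetherian X] (hX : Scheme.IsRegular X)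
    {E : CartierDivisor X} (hE : E.IsEffective) (g : X ⟶ X) [IsIso g]
    (hfix : ∀ ζ ∈ divisorialPoints hE.idealSheaf, g.base '' closure ({ζ} : Set X) = closure {ζ}) :
    (E.pullback g).SameDivisor E := by
  refine sameDivisor_of_forall_ordAt_eq hX fun z hz => ?_
  haveI : IsRegularLocalRing (X.presheaf.stalk z) := hX z
  haveI : IsRegularLocalRing (X.presheaf.stalk (g.base z)) := hX (g.base z)
  haveI := isDomain_of_isRegularLocalRing (X.presheaf.stalk z)
  haveI := isDomain_of_isRegularLocalRing (X.presheaf.stalk (g.base z))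
  haveI := isDiscreteValuationRing_stalk_of_coheight_eq_one hX hz
  have hgz : coheight (g.base z) = 1 := by rw [AlgebraicGeometry.coheight_eq_of_isOpenImmersion g]; exact hz
  haveI := isDiscreteValuationRing_stalk_of_coheight_eq_one hX hgz
  rw [E.ordAt_pullback_of_isIso g z]
  exact hE.ordAt_base_eq_of_forall_image_closure_eq hX g hfix hz

end CartierDivisor

/-! ## §2 On an abelian variety: fixing the prime components of `Supp D` puts `x` in `K(D)` -/

namespace AbelianVariety

open CartierDivisor

variable {k : Type u} [Field k] (A : AbelianVariety k)

/-- **`t_x(cl ζ) = cl ζ` for every prime component `cl ζ` of `Supp D` ⇒ `t_x^*D ≈ D`** (`D ≥ 0` on an abelian variety; abelian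
varieties are regular ★ `isRegularLocalRing_stalk` and Noetherian ★ `isNoetherian_left`). [cite: MumfordAV1970, §6 Application 1 and its proof (pp. 60–61)] -/
theorem pullback_translation_sameDivisor_of_forall_image_closure_eq {D : CartierDivisor A.X.left} (hD : D.IsEffective)
    {x : A.Points k} (hx : ∀ ζ ∈ divisorialPoints hD.idealSheaf,
      (A.translation x).left.base '' closure ({ζ} : Set A.X.left) = closure {ζ}) :
    (D.pullback (A.translation x).left).SameDivisor D := by
  haveI : IsNoetherian A.X.left := A.isNoetherian_left
  exact hD.pullback_sameDivisor_of_forall_image_closure_eq (fun p => A.isRegularLocalRing_stalk p) (A.translation x).left hx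

/-- **`t_x` fixing every prime component of `Supp D` ⇒ `x ∈ K(D)`** (`t_x^*D ≈ D`, a fortiori `t_x^*D ∼ D`).
[cite: MumfordAV1970, §6 Application 1 and its proof (pp. 60–61)] -/
theorem mem_KTheta_of_forall_image_translation_closure_eq {D : CartierDivisor A.X.left} (hD : D.IsEffective)
    {x : A.Points k} (hx : ∀ ζ ∈ divisorialPoints hD.idealSheaf,
      (A.translation x).left.base '' closure ({ζ} : Set A.X.left) = closure {ζ}) :
    x ∈ A.KTheta D :=
  (A.mem_KTheta_iff' D x).mpr (A.pullback_translation_sameDivisor_of_forall_image_closure_eq hD hx).linEquiv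

/-- **The component stabiliser of `Supp D` lies in `K(D)`; so it is finite when `K(D)(k)` is.**
[cite: MumfordAV1970, §6 Application 1 and its proof (pp. 60–61)] -/
theorem finite_componentStabilizer_of_finite_KTheta {D : CartierDivisor A.X.left} (hD : D.IsEffective)
    (hK : (A.KTheta D : Set (A.Points k)).Finite) :
    {x : A.Points k | ∀ ζ ∈ divisorialPoints hD.idealSheaf,
      (A.translation x).left.base '' closure ({ζ} : Set A.X.left) = closure {ζ}}.Finite :=
  hK.subset fun _ hx => A.mem_KTheta_of_forall_image_translation_closure_eq hD hx

/-! ## §3 Mumford §6 Application 1, (ii) ⇒ (iv), for an arbitrary effective divisor (granted (H) for irreducible supports) -/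

/-- **Mumford, *Abelian Varieties*, §6 Application 1: an effective divisor `D` on an abelian variety over `k = k̄` with `K(D)(k)`
FINITE is AMPLE** — for an ARBITRARY (possibly reducible) effective `D`, granted the translation lemma (H) for divisors with
irreducible support (`hH`, the letter of `Motives/AbelianVarietyTranslationLemma` quantified over the divisor): `K(D)(k)` finite
⇒ the component stabiliser of `Supp D` is finite (§2) ⇒ ample (★ `isAmple_of_isEffective_of_finite_componentStabilizer_of_translationLemma`).
[cite: MumfordAV1970, §6 Application 1 and its proof (pp. 60–61)] -/
theorem isAmple_of_isEffective_of_finite_KTheta_of_translationLemma [IsAlgClosed k]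
    (hH : ∀ (D' : CartierDivisor A.X.left), D'.IsEffective → IsIrreducible (D'.nonvanishing 1)ᶜ →
      ∀ (Z : Set A.X.left), IsClosed Z → IsIrreducible Z → ∀ (y : A.Points k),
        Z ⊆ (A.translation y).left.base ⁻¹' (D'.nonvanishing 1) → ∀ (z z' : A.Points k), z.pt ∈ Z → z'.pt ∈ Z →
          (A.translation (z * z'⁻¹)).left.base '' (D'.nonvanishing 1)ᶜ = (D'.nonvanishing 1)ᶜ)
    {D : CartierDivisor A.X.left} (hD : D.IsEffective) (hK : (A.KTheta D : Set (A.Points k)).Finite) : D.IsAmple :=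
  A.isAmple_of_isEffective_of_finite_componentStabilizer_of_translationLemma hH hD
    (A.finite_componentStabilizer_of_finite_KTheta hD hK)

/-- **Mumford §6 Application 1 in the `K(D) = ⊥` spelling** (the G5 socket `stub_V7c` shape, now for an ARBITRARY effective
`D`), granted (H) for irreducible supports. [cite: MumfordAV1970, §6 Application 1 and its proof (pp. 60–61)] -/
theorem isAmple_of_isEffective_of_KTheta_eq_bot_of_translationLemma [IsAlgClosed k]
    (hH : ∀ (D' : CartierDivisor A.X.left), D'.IsEffective → IsIrreducible (D'.nonvanishing 1)ᶜ →
      ∀ (Z : Set A.X.left), IsClosed Z → IsIrreducible Z → ∀ (y : A.Points k),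
        Z ⊆ (A.translation y).left.base ⁻¹' (D'.nonvanishing 1) → ∀ (z z' : A.Points k), z.pt ∈ Z → z'.pt ∈ Z →
          (A.translation (z * z'⁻¹)).left.base '' (D'.nonvanishing 1)ᶜ = (D'.nonvanishing 1)ᶜ)
    {D : CartierDivisor A.X.left} (hD : D.IsEffective) (hK : A.KTheta D = ⊥) : D.IsAmple :=
  A.isAmple_of_isEffective_of_finite_KTheta_of_translationLemma hH hD
    (by rw [hK]; exact (Set.finite_singleton (1 : A.Points k)).subset fun x hx => (Subgroup.mem_bot.mp hx : x = 1) ▸ rfl)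

/-! ## §4 (ed. 2) Unconditional forms: the translation lemma (H) is ★ `Motives/AbelianVarietyTranslationLemma` (p768209) -/

/-- The translation lemma (H) for divisors with irreducible support, in the `hH` binder shape of §3 (★
`AbelianVariety.image_translation_support_eq_of_subset_preimage`, A-p06 (g16)). [cite: MumfordAV1970, §6 Application 1 and its proof (pp. 60–61)] -/
theorem translationLemma_of_isIrreducible [IsAlgClosed k] :
    ∀ (D' : CartierDivisor A.X.left), D'.IsEffective → IsIrreducible (D'.nonvanishing 1)ᶜ →
      ∀ (Z : Set A.X.left), IsClosed Z → IsIrreducible Z → ∀ (y : A.Points k),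
        Z ⊆ (A.translation y).left.base ⁻¹' (D'.nonvanishing 1) → ∀ (z z' : A.Points k), z.pt ∈ Z → z'.pt ∈ Z →
          (A.translation (z * z'⁻¹)).left.base '' (D'.nonvanishing 1)ᶜ = (D'.nonvanishing 1)ᶜ :=
  fun _ hD' hirr' _ hZc hZi y hy _ _ hz hz' =>
    A.image_translation_support_eq_of_subset_preimage hD' hirr' hZc hZi y hy hz hz'

/-- **Mumford, *Abelian Varieties*, §6 Application 1, (ii) ⇒ (iv) — UNCONDITIONAL, ARBITRARY effective divisor**: on an abelian
variety over an algebraically closed field, an effective Cartier divisor `D` with `K(D)(k) = {x : t_x^*D ∼ D}` FINITE is AMPLE.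
[cite: MumfordAV1970, §6 Application 1 and its proof (pp. 60–61)] -/
theorem isAmple_of_finite_KTheta [IsAlgClosed k] {D : CartierDivisor A.X.left} (hD : D.IsEffective)
    (hK : (A.KTheta D : Set (A.Points k)).Finite) : D.IsAmple :=
  A.isAmple_of_isEffective_of_finite_KTheta_of_translationLemma A.translationLemma_of_isIrreducible hD hK

/-- **Mumford §6 Application 1, (ii) ⇒ (iv), in the `K(D) = ⊥` spelling — unconditional, arbitrary effective `D`** (the G5 socket
`stub_V7c` shape with no irreducibility or multiplicity hypothesis). [cite: MumfordAV1970, §6 Application 1 and its proof (pp. 60–61)] -/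
theorem isAmple_of_KTheta_eq_bot [IsAlgClosed k] {D : CartierDivisor A.X.left} (hD : D.IsEffective)
    (hK : A.KTheta D = ⊥) : D.IsAmple :=
  A.isAmple_of_isEffective_of_KTheta_eq_bot_of_translationLemma A.translationLemma_of_isIrreducible hD hK

/-- **Mumford §6 Application 1, (ii) ⇔ (iv), for an effective divisor: `D` is ample iff `K(D)(k)` is finite** (⇐ above; ⇒ ★
`AbelianVariety.finite_KTheta`, Mumford p. 60 «if `L(D)` is ample then `K(L(D))` is finite»). [cite: MumfordAV1970, §6 Application 1 and its proof (pp. 60–61)] -/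
theorem isAmple_iff_finite_KTheta [IsAlgClosed k] {D : CartierDivisor A.X.left} (hD : D.IsEffective) :
    D.IsAmple ↔ (A.KTheta D : Set (A.Points k)).Finite :=
  ⟨fun h => A.finite_KTheta h, fun h => A.isAmple_of_finite_KTheta hD h⟩

/-- **The component stabiliser of `Supp D` is finite iff `K(D)(k)` is finite** (for `D ≥ 0` over `k = k̄`): ⇐ §2; ⇒ the component
stabiliser finite ⇒ `D` ample (★ `isAmple_of_isEffective_of_finite_componentStabilizer_of_translationLemma` + (H)) ⇒ `K(D)` finite.
[cite: MumfordAV1970, §6 Application 1 and its proof (pp. 60–61)] -/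
theorem finite_componentStabilizer_iff_finite_KTheta [IsAlgClosed k] {D : CartierDivisor A.X.left} (hD : D.IsEffective) :
    {x : A.Points k | ∀ ζ ∈ divisorialPoints hD.idealSheaf,
      (A.translation x).left.base '' closure ({ζ} : Set A.X.left) = closure {ζ}}.Finite ↔
      (A.KTheta D : Set (A.Points k)).Finite :=
  ⟨fun h => A.finite_KTheta
      (A.isAmple_of_isEffective_of_finite_componentStabilizer_of_translationLemma A.translationLemma_of_isIrreducible hD h),
    fun h => A.finite_componentStabilizer_of_finite_KTheta hD h⟩

/-! ## §5 (ed. 3) Mumford's `H(D)`: the divisor-stabiliser `{x : t_x^*D = D}` -/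

/-- **`H(D) ⊆ K(D)`**: if `t_x^*D = D` as divisors (`SameDivisor`) then `t_x^*D ∼ D`. [cite: MumfordAV1970, §6 Application 1 and its proof (pp. 60–61)] -/
theorem mem_KTheta_of_pullback_translation_sameDivisor {D : CartierDivisor A.X.left} {x : A.Points k}
    (hx : (D.pullback (A.translation x).left).SameDivisor D) : x ∈ A.KTheta D :=
  (A.mem_KTheta_iff' D x).mpr hx.linEquiv

/-- **The component stabiliser of `Supp D` lies in `H(D) = {x : t_x^*D = D}`** (`D ≥ 0`): a translation fixing every prime
component of `Supp D` fixes `D` as a divisor (§1–§2). [cite: MumfordAV1970, §6 Application 1 and its proof (pp. 60–61)] -/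
theorem componentStabilizer_subset_sameDivisorStabilizer {D : CartierDivisor A.X.left} (hD : D.IsEffective) :
    {x : A.Points k | ∀ ζ ∈ divisorialPoints hD.idealSheaf,
      (A.translation x).left.base '' closure ({ζ} : Set A.X.left) = closure {ζ}} ⊆
      {x : A.Points k | (D.pullback (A.translation x).left).SameDivisor D} :=
  fun _ hx => A.pullback_translation_sameDivisor_of_forall_image_closure_eq hD hx

/-- **Mumford, *Abelian Varieties*, §6 Application 1, (i) ⇒ (iv): an effective divisor `D` on an abelian variety over `k = k̄` whose
divisor-stabiliser `H(D) = {x ∈ A(k) : t_x^*D = D}` is FINITE is AMPLE** (arbitrary effective `D`; `H(D)` finite ⇒ the component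
stabiliser is finite ⇒ ample). [cite: MumfordAV1970, §6 Application 1 and its proof (pp. 60–61)] -/
theorem isAmple_of_finite_sameDivisorStabilizer [IsAlgClosed k] {D : CartierDivisor A.X.left} (hD : D.IsEffective)
    (hH : {x : A.Points k | (D.pullback (A.translation x).left).SameDivisor D}.Finite) : D.IsAmple :=
  A.isAmple_of_isEffective_of_finite_componentStabilizer_of_translationLemma A.translationLemma_of_isIrreducible hD
    (hH.subset (A.componentStabilizer_subset_sameDivisorStabilizer hD))

/-- **An ample divisor has finite divisor-stabiliser `H(D)`** (`H(D) ⊆ K(D)`, finite for `D` ample ★ `finite_KTheta`; Mumford p. 60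
(iv) ⇒ (i)). [cite: MumfordAV1970, §6 Application 1 and its proof (pp. 60–61)] -/
theorem finite_sameDivisorStabilizer_of_isAmple [IsAlgClosed k] {D : CartierDivisor A.X.left} (hD : D.IsAmple) :
    {x : A.Points k | (D.pullback (A.translation x).left).SameDivisor D}.Finite :=
  (A.finite_KTheta hD).subset fun _ hx => A.mem_KTheta_of_pullback_translation_sameDivisor hx

/-- **Mumford §6 Application 1, (i) ⇔ (iv), for an effective divisor: `D` is ample iff `H(D) = {x : t_x^*D = D}` is finite.**
[cite: MumfordAV1970, §6 Application 1 and its proof (pp. 60–61)] -/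
theorem isAmple_iff_finite_sameDivisorStabilizer [IsAlgClosed k] {D : CartierDivisor A.X.left} (hD : D.IsEffective) :
    D.IsAmple ↔ {x : A.Points k | (D.pullback (A.translation x).left).SameDivisor D}.Finite :=
  ⟨fun h => A.finite_sameDivisorStabilizer_of_isAmple h, fun h => A.isAmple_of_finite_sameDivisorStabilizer hD h⟩

end AbelianVariety

end Literature.AlgebraicGeometry.Motives

end
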